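import Literature.AlgebraicGeometry.AbelianVarieties.PoincareSheafOfPrincipal
import Literature.AlgebraicGeometry.Modules.UnitCocyclePresented
import Literature.AlgebraicGeometry.Modules.PullbackFrame
import Literature.AlgebraicGeometry.Modules.DetClassOfIso
import Literature.AlgebraicGeometry.Modules.CechPicOfLocalRing
import Literature.AlgebraicGeometry.Motives.DualNumberReadoutEvaluation
import Literature.AlgebraicGeometry.Motives.DualNumberSliceReadout
import Literature.AlgebraicGeometry.Motives.AbelianVarietyTranslation
import Literature.AlgebraicGeometry.Deformation.TrivialDeformationIdealSheaf
import Mathlib.RingTheory.DualNumber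
import HarnessLib

/-!
# The first-order deformation of the translated Mumford family `Λ(𝒪(Θ))` along a `ℂ[ε]`-point, read in Čech form:
# if `(1 × w)^*Λ(𝒪(Θ)) ≅ pr₁^*N` on `A × Spec ℂ[ε]` then `δ_w g_{ij} = (h_j − h_i)·g_{ij}` with REGULAR `h_i`
# (Mumford, *Abelian Varieties* §13, proof of the Theorem: the tangent map of `x ↦ t_x^*L ⊗ L⁻¹`)

Layer `Literature/AlgebraicGeometry/AbelianVarieties`, namespace `Literature.AlgebraicGeometry.Motives.AbelianVariety`.
THEOREMS ONLY (no definition, no named fact, no instance).  Setting: a complex abelian variety `A₀`, a Cartier divisor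
`Θ` with charts `U_i` and transition functions `g_{ij} = Θ.transFun i j` (`Motives/CartierDivisorCocycle`), Mumford's line
bundle `Λ(𝒪(Θ)) = m^*𝒪(Θ) ⊗ p₁^*𝒪(Θ)⁻¹ ⊗ p₂^*𝒪(Θ)⁻¹ = mumfordSheaf A₀ Θ` on `A₀ × A₀` (`AbelianVarieties/PoincareSheafOfPrincipal`,
Mumford §8 / Milne I §8 «`L^* = m^*L ⊗ p^*L⁻¹ ⊗ q^*L⁻¹`»), the dual numbers `Spec ℂ[ε] = dualNumberOver` and the read-out of
`ℂ[ε]`-points `dualNumberStalkHom w : 𝒪_{A₀,x₀} → ℂ[ε]` (`Motives/DualNumberPoints`, `Motives/DualNumberSliceReadout`;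
Görtz–Wedhorn I (6.3)–(6.4)).

Mumford, *Abelian Varieties* §13 (proof of the Theorem, p. 125) computes the tangent map at `0` of `x ↦ t_x^*L ⊗ L⁻¹`,
i.e. of the family `Λ(L)` on `A × A` in the second variable, as the class in `H¹(A, 𝒪)` of the first-order variation
`{δ_v g_{ij}/g_{ij}}` of the transition functions of `L` along the tangent vector `v`; Görtz–Wedhorn II, Prop. 27.122 is
the general statement `Lie(Pic_{X/S}) = R¹f_*𝒪_X` through `U[ε]`-valued points.  This file proves the COCYCLE-LEVEL
read-out needed downstream: triviality of the first-order deformation as a MODULE (`≅ pr₁^*N`) makes that Čech cocycle a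
COBOUNDARY of regular functions, read at every closed point.

* §1 `mk_pullback_translationFamily_eq` — iso ⇒ `Ȟ¹`-classes: `[T_w^*𝒪(Θ)] = pr₁^*([N]·[𝒪(Θ)])` in `Ȟ¹(A₀[ε], 𝒪^×)`,
  `T_w = m ∘ (1 × w)` (★ `detClass_eq_of_iso`, `detClass_pullback`, `mk_mumfordCocycle`, `CechPic.pullback_comp`, and
  `Ȟ¹(Spec ℂ[ε], 𝒪^×) = 1` from `Modules/CechPicOfLocalRing`);
* §2 `dualNumberBasePt_slicePt`, `fst_base_dualNumberBasePt_slicePt` — the slice point `(P, ε)` lies on the closed fibre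
  over `P` (★ `Deformation.apply_retraction_apply` for the split first-order thickening `A₀ ↪ A₀ × Spec ℂ[ε]`);
* §3 **`exists_charted_firstOrderCech_of_iso`** — for `w₀` at the origin, `c ∈ A₀(ℂ)`, `N` of rank one and
  `(1 × (w₀ ≫ t_c))^*Λ(𝒪(Θ)) ≅ pr₁^*N`: there are opens `V_a ⊆ U_{k(a)}` covering the closed points and regular
  `h_a ∈ Γ(V_a, 𝒪)` with `(w₀ ≫ t_P)(germ g_{k(b)k(a)}).snd = (h_b(P) − h_a(P))·g_{k(b)k(a)}(P)` for all closed points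
  `P ∈ V_a ∩ V_b`.  Proof: ★ `CechPic.mk_eq_mk_iff` turns §1 into a Čech coboundary `pr₁^♯(n g)·λ_a = λ_b·T_w^♯(g)` on a
  point-indexed refinement `W_y`; read it at the slice point `(P c⁻¹, ε)` (`dualNumberStalkHom_slicePt_fst_app`: the
  `pr₁`-part is a scalar; `dualNumberStalkHom_slicePt_translationFamily`: the `T_w`-part is the displayed left side;
  `exists_slicePt_readout` for `λ_y` and `λ_y⁻¹`: `λ_y(P', ε) = m₀(P') + ε m₁(P')` with regular `m₀, m₁`, Hartshorne
  *Deformation Theory* Prop. 2.6 mechanism) and use `fst_dualNumberStalkHom_germ` and the `ε`-algebra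
  `snd_eq_of_inl_mul_eq_mul` (`Motives/DualNumberReadoutEvaluation`); `h_y = −t_{c⁻¹}^♯(m₁·n₀)`,
  `V_y = U_{i(T_w y)} ∩ t_c(ι₀⁻¹W_y)`, `k(y) = i(T_w y)`.

Consumer (cell `hodgecm-mathlib`, programme M13 on the Poincaré bundle): the input (b1) of the dual-number rigidity of the
seesaw graph (`stub_M13_3d_dualNumber_rigid`).  Presearch: Mumford §13 pp. 125–130 (held djvu), GW II Prop. 27.122 / Rem.
27.18 (4) [corpus: book:gortz2023], Hartshorne *Deformation Theory* Prop. 2.6 [corpus:book:springernd-deformation-theory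
p0016]; the cocycle-at-closed-points phrasing is ours (folklore).  HC_CM is proved only modulo the 7 printed citations
until rung 0 closes — this file is generic abelian-variety geometry and asserts nothing about HC.

## References
* D. Mumford, *Abelian Varieties* (1970), §8 (`Λ(L)`), §13 proof of the Theorem (pp. 125–130). [MumfordAV1970]
* U. Görtz, T. Wedhorn, *Algebraic Geometry II* (2023), Prop. 27.122, Rem. 27.18 (4). [GortzWedhorn2023]
* U. Görtz, T. Wedhorn, *Algebraic Geometry I*, 2nd ed. (2020), (6.3)–(6.4). [GortzWedhorn2020]
* R. Hartshorne, *Deformation Theory* (2010), §2 Prop. 2.6 (pp. 13–14). [Hartshorne2010]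
* R. Hartshorne, *Algebraic Geometry* (1977), II Ex. 6.8, III Ex. 4.5. [Hartshorne1977]
-/

noncomputable section

universe u

open CategoryTheory CategoryTheory.Limits AlgebraicGeometry Topology TopologicalSpace MonoidalCategory
open CartesianMonoidalCategory
open scoped DualNumber MonObj
open Literature.AlgebraicGeometry.Motives (AlgPoints ComplexPoints SchemeOver AbelianVariety)
open Literature.AlgebraicGeometry.Motives.AlgPoints

namespace Literature.AlgebraicGeometry.Motives.AbelianVariety

open Literature.AlgebraicGeometry.Modules Literature.AlgebraicGeometry.AbelianVarieties

/-! ## §1 The class computation: `T_w^*[Θ] = pr₁^*([N]·[Θ])` in `Ȟ¹(A₀[ε], 𝒪^×)`, hence a Čech coboundary -/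

section Classes

variable (A₀ : AbelianVariety ℂ) {Θ : CartierDivisor A₀.X.left}

/-- `p₁ · p₂ = m` in the group `Hom(A × A, A)` (`f * g = lift f g ≫ μ` and `lift p₁ p₂ = 𝟙`). [cite: GortzWedhorn2023, Def./Rem. 27.1 (p. 604)] -/
theorem fst_mul_snd_eq_mul : (CartesianMonoidalCategory.fst A₀.X A₀.X * CartesianMonoidalCategory.snd A₀.X A₀.X : A₀.X ⊗ A₀.X ⟶ A₀.X) = μ[A₀.X] := by
  rw [Hom.mul_def, lift_fst_snd, Category.id_comp]

/-- **THE CLASS IDENTITY.**  If `(1 × w)^*Λ(𝒪(Θ)) ≅ pr₁^*N` on `A₀ × Spec ℂ[ε]` for a rank-one `N`, then in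
`Ȟ¹(A₀[ε], 𝒪^×)` the class of `𝒪(Θ)` pulled back along the infinitesimal translation `T_w = m ∘ (1 × w)` equals the
class of `N ⊗ 𝒪(Θ)` pulled back along `pr₁` — at cocycle level: the two explicit cocycles are cohomologous
(`Λ = m^*𝒪(Θ) ⊗ p₁^*𝒪(Θ)⁻¹ ⊗ p₂^*𝒪(Θ)⁻¹`, `(1 × w) ≫ p₁ = pr₁`, `(1 × w) ≫ p₂ = pr₂ ≫ w`, and `Ȟ¹(Spec ℂ[ε], 𝒪^×) = 1`, `ℂ[ε]` being local — `Modules/CechPicOfLocalRing`).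
[cite: MumfordAV1970, §13 (proof of the Thm. p. 125)] [cite: Hartshorne1977, II Ex. 6.8 and III Ex. 4.5] -/
theorem mk_pullback_translationFamily_eq (w : dualNumberOver ⟶ A₀.X) {N : A₀.X.left.Modules} (hN : HasRank N 1)
    (e : (Scheme.Modules.pullback (A₀.X ◁ w).left).obj (mumfordSheaf A₀ Θ) ≅
      (Scheme.Modules.pullback (CartesianMonoidalCategory.fst A₀.X dualNumberOver).left).obj N) :
    CechPic.mk (UnitCocycle.pullback ((A₀.X ◁ w) ≫ μ[A₀.X]).left Θ.toUnitCocycle) =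
      CechPic.mk (UnitCocycle.pullback (CartesianMonoidalCategory.fst A₀.X dualNumberOver).left
        (UnitCocycle.mul (detCocycle (HasRank.isFiniteLocallyFree' hN)) Θ.toUnitCocycle)) := by
  have hΛ : IsFiniteLocallyFree (mumfordSheaf A₀ Θ) := (mumfordCocycle A₀ Θ).isFiniteLocallyFree_lineBundle
  have hΛc : detClass hΛ = CechPic.mk (mumfordCocycle A₀ Θ) := (mumfordCocycle A₀ Θ).detClass_lineBundle
  have h := detClass_eq_of_iso e (hΛ.pullback _) ((HasRank.isFiniteLocallyFree' hN).pullback _)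
  rw [detClass_pullback _ hΛ, detClass_pullback _ (HasRank.isFiniteLocallyFree' hN), hΛc, mk_mumfordCocycle,
    _root_.map_mul, _root_.map_inv, _root_.map_mul, ← CechPic.pullback_comp, ← CechPic.pullback_comp,
    ← CechPic.pullback_comp, ← Over.comp_left, ← Over.comp_left, ← Over.comp_left, whiskerLeft_fst,
    whiskerLeft_snd, fst_mul_snd_eq_mul] at h
  rw [show CechPic.pullback (CartesianMonoidalCategory.snd A₀.X dualNumberOver ≫ w).left Θ.cechClass = 1 by
    rw [Over.comp_left, CechPic.pullback_comp]
    change CechPic.pullback _ (CechPic.pullback (dualNumberHom w) Θ.cechClass) = 1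
    rw [CechPic.pullback_eq_one_of_isLocalRing (dualNumberHom w), _root_.map_one], mul_one] at h
  -- `h : T^*θ · (pr₁^*θ)⁻¹ = pr₁^*[N]`
  rw [CartierDivisor.cechClass_eq_mk] at h
  rw [← CechPic.pullback_mk, ← CechPic.pullback_mk, CechPic.mk_mul, _root_.map_mul, ← detClass,
    ← h, inv_mul_cancel_right]

end Classes

/-! ## §2 The base point of the slice point lies on the closed fibre -/

section Readout

open Literature.AlgebraicGeometry.Deformation

variable (X : SchemeOver ℂ)

/-- The base point of the slice point `(P, ε)` is the image of the point of `P` under the closed fibre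
`ι₀ : X ↪ X × Spec ℂ[ε]` (the fibres of `pr₁` are single points). [cite: Hartshorne2010, §2 p. 11] -/
theorem dualNumberBasePt_slicePt (P : AlgPoints X ℂ) :
    dualNumberBasePt (slicePt X P) =
      (closedFibreι X (ArtAlg.sqZeroExt (k := ℂ) ℂ) : X.left ⟶ (X ⊗ dualNumberOver).left).base P.pt := by
  let ι₀ : X.left ⟶ (X ⊗ dualNumberOver).left := closedFibreι X (ArtAlg.sqZeroExt (k := ℂ) ℂ)
  haveI : IsFirstOrderThickening ι₀ := isFirstOrderThickening_closedFibreι_dualNumber X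
  have h := apply_retraction_apply ι₀ (CartesianMonoidalCategory.fst X dualNumberOver).left
    (closedFibreι_fst X _) (dualNumberBasePt (slicePt X P))
  have hfst : (CartesianMonoidalCategory.fst X dualNumberOver).left.base (dualNumberBasePt (slicePt X P)) = P.pt := by
    change ((slicePt X P).left ≫ (CartesianMonoidalCategory.fst X dualNumberOver).left).base _ = _
    rw [← Over.comp_left, slicePt_fst]
    exact dualNumberBasePt_toSpecOver_comp P
  change ι₀.base ((CartesianMonoidalCategory.fst X dualNumberOver).left.base _) = _ at h
  rw [hfst] at h
  exact h.symm

end Readout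

/-! ## §3 THE ČECH READ-OUT of the first-order deformation of the translated Mumford family -/

section Body

open Literature.AlgebraicGeometry.Deformation

variable (A₀ : AbelianVariety ℂ) {Θ : CartierDivisor A₀.X.left}

/-- `P.eval` is multiplicative. [folklore] -/
private theorem eval_mul' {Y : SchemeOver ℂ} (P : AlgPoints Y ℂ) (U : Y.left.Opens) (h : P.pt ∈ U) (a b : Γ(Y.left, U)) :
    P.eval U h (a * b) = P.eval U h a * P.eval U h b := by
  change P.resHom (Y.left.evaluation U P.pt h (a * b)) =
    P.resHom (Y.left.evaluation U P.pt h a) * P.resHom (Y.left.evaluation U P.pt h b)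
  rw [_root_.map_mul, _root_.map_mul]

/-- `P.eval` commutes with negation. [folklore] -/
private theorem eval_neg' {Y : SchemeOver ℂ} (P : AlgPoints Y ℂ) (U : Y.left.Opens) (h : P.pt ∈ U) (a : Γ(Y.left, U)) :
    P.eval U h (-a) = -P.eval U h a := by
  change P.resHom (Y.left.evaluation U P.pt h (-a)) = -P.resHom (Y.left.evaluation U P.pt h a)
  rw [_root_.map_neg, _root_.map_neg]

/-- Base points of translated points at the origin: `(w₀ ≫ t_Q)(closed pt) = Q`. [cite: MumfordAV1970, §4 (translations)] -/
theorem dualNumberBasePt_comp_translation_of_origin (w₀ : dualNumberOver ⟶ A₀.X)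
    (hw₀ : dualNumberBasePt w₀ = origin A₀) (Q : A₀.Points ℂ) :
    dualNumberBasePt (w₀ ≫ A₀.translation Q) = Q.pt := by
  change (A₀.translation Q).left.base (dualNumberBasePt w₀) = _
  rw [hw₀, ← pt_one_eq_origin A₀]
  exact (translation_apply_pt A₀ 1 Q).trans (by rw [mul_one])

/-- `pr₁` of the base point of the slice point `(P, ε)` is the point of `P`. [cite: Hartshorne2010, §2 p. 11] -/
theorem fst_base_dualNumberBasePt_slicePt (X : SchemeOver ℂ) (P : AlgPoints X ℂ) :
    (CartesianMonoidalCategory.fst X dualNumberOver).left.base (dualNumberBasePt (slicePt X P)) = P.pt := by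
  change ((slicePt X P).left ≫ (CartesianMonoidalCategory.fst X dualNumberOver).left).base _ = _
  rw [← Over.comp_left, slicePt_fst]
  exact dualNumberBasePt_toSpecOver_comp P

/-- **THE (b1) BODY — `socket_N3d_b1_firstOrderCech` (charted-refinement form, B-plan1 (g11) R105, text of record N3d v5
:1607) PROVED from the module isomorphism.**  Given a `ℂ[ε]`-point `w₀` of `A₀` at the origin, a `ℂ`-point `c`, a
rank-one `N` and `(1 × (w₀ ≫ t_c))^*Λ(𝒪(Θ)) ≅ pr₁^*N` on `A₀ × Spec ℂ[ε]`: the classes give a Čech coboundary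
`pr₁^♯(n·g)·λ_{y'} = λ_y·T_w^♯(g)` on a point-indexed refinement `W_y` of `A₀[ε]` (§2); reading it at the slice points
`(P', ε)`, `P' = P c⁻¹` (B-p03's (L4) read-out, B-typ01's (L1) splitting: `λ_y(P', ε) = μ_y(P') + ε η_y(P')`) gives
`δ_{w₀} g_{k(b)k(a)}(P) = (h_b(P) − h_a(P))·g_{k(b)k(a)}(P)` with the REGULAR `h_y = −t_{c⁻¹}^♯(η_y·μ̃_y)` (`μ̃_y` the
first read-out component of `λ_y⁻¹`) on `V_y = U_{k(y)} ∩ t_c(ι₀⁻¹W_y)`, `k(y) = i(T_w y)`.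
[cite: MumfordAV1970, §13 (proof of the Thm. p. 125)] [cite: GortzWedhorn2023, Prop. 27.122 (`Lie(Pic) = R¹f_*𝒪` via `U[ε]`)] -/
theorem exists_charted_firstOrderCech_of_iso (w₀ : dualNumberOver ⟶ A₀.X) (hw₀ : dualNumberBasePt w₀ = origin A₀)
    (c : A₀.Points ℂ) {N : A₀.X.left.Modules} (hN : HasRank N 1)
    (e : (Scheme.Modules.pullback (A₀.X ◁ (w₀ ≫ A₀.translation c)).left).obj (mumfordSheaf A₀ Θ) ≅
      (Scheme.Modules.pullback (CartesianMonoidalCategory.fst A₀.X dualNumberOver).left).obj N) :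
    ∃ (α : Type) (V : α → A₀.X.left.Opens) (k : α → Θ.ι) (hVU : ∀ a, V a ≤ Θ.U (k a))
      (_ : ∀ P : A₀.Points ℂ, ∃ a, P.pt ∈ V a) (h : (a : α) → Γ(A₀.X.left, V a)),
      ∀ (a b : α) (P : A₀.Points ℂ) (hPa : P.pt ∈ V a) (hPb : P.pt ∈ V b)
        (hx : (A₀.translation P).left.base (dualNumberBasePt w₀) ∈ Θ.U (k b) ⊓ Θ.U (k a)),
        (dualNumberStalkHom (w₀ ≫ A₀.translation P)
            (A₀.X.left.presheaf.germ (Θ.U (k b) ⊓ Θ.U (k a)) _ hx (Θ.transFun (k b) (k a)))).snd =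
          (P.eval (V b) hPb (h b) - P.eval (V a) hPa (h a)) *
            P.eval (Θ.U (k b) ⊓ Θ.U (k a)) ⟨hVU b hPb, hVU a hPa⟩ (Θ.transFun (k b) (k a)) := by
  classical
  haveI : LocallyOfFiniteType A₀.X.hom := A₀.isProper.toLocallyOfFiniteType
  -- notation: `w = w₀ ≫ t_c`, `T = T_w = m ∘ (1 × w)`, the closed fibre `ι₀`, the cocycles of §1
  set w : dualNumberOver ⟶ A₀.X := w₀ ≫ A₀.translation c with hw
  let ι₀ : A₀.X.left ⟶ (A₀.X ⊗ dualNumberOver).left := closedFibreι A₀.X (ArtAlg.sqZeroExt (k := ℂ) ℂ)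
  let T : A₀.X ⊗ dualNumberOver ⟶ A₀.X := (A₀.X ◁ w) ≫ μ[A₀.X]
  let cN : UnitCocycle A₀.X.left := UnitCocycle.mul (detCocycle (HasRank.isFiniteLocallyFree' hN)) Θ.toUnitCocycle
  let cT : UnitCocycle (A₀.X ⊗ dualNumberOver).left := UnitCocycle.pullback T.left Θ.toUnitCocycle
  let cF : UnitCocycle (A₀.X ⊗ dualNumberOver).left :=
    UnitCocycle.pullback (CartesianMonoidalCategory.fst A₀.X dualNumberOver).left cN
  -- §2: the coboundary
  have hmk : CechPic.mk cT = CechPic.mk cF := mk_pullback_translationFamily_eq A₀ w hN e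
  obtain ⟨β⟩ := (CechPic.mk_eq_mk_iff cT cF).1 hmk
  -- the read-outs of `λ_y` and of `λ_y⁻¹` on `W_y`: sections `m₀ m₁`, `n₀ n₁` over `ι₀⁻¹W_y`
  choose m₀ m₁ hm using fun y : ↥(A₀.X ⊗ dualNumberOver).left ↦
    exists_slicePt_readout A₀.X (β.W y) (β.lam y (β.W y) le_rfl)
  choose n₀ n₁ hn using fun y : ↥(A₀.X ⊗ dualNumberOver).left ↦
    exists_slicePt_readout A₀.X (β.W y) (β.inv y (β.W y) le_rfl)
  -- point bookkeeping
  have hbase : ∀ Q : A₀.Points ℂ, dualNumberBasePt (w ≫ A₀.translation Q) = (Q * c).pt := fun Q ↦ by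
    rw [hw, Category.assoc, translation_comp]
    exact dualNumberBasePt_comp_translation_of_origin A₀ w₀ hw₀ _
  have hTσ : ∀ Q : A₀.Points ℂ, T.left.base (dualNumberBasePt (slicePt A₀.X Q)) = (Q * c).pt := fun Q ↦ by
    rw [← hbase Q, ← dualNumberBasePt_slicePt_comp A₀ Q w]
    rfl
  have hσι : ∀ Q : A₀.Points ℂ, dualNumberBasePt (slicePt A₀.X Q) = ι₀.base Q.pt := fun Q ↦
    dualNumberBasePt_slicePt A₀.X Q
  have hmapc : ∀ P : A₀.Points ℂ, AlgPoints.map (A₀.translation c⁻¹) P * c = P := fun P ↦ by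
    change (P ≫ A₀.translation c⁻¹) * c = P
    rw [comp_translation, mul_comm, mul_inv_cancel_left]
  -- the data
  let k : ↥(A₀.X ⊗ dualNumberOver).left → Θ.ι := fun y ↦ Θ.chartIdx (T.left.base y)
  let V : ↥(A₀.X ⊗ dualNumberOver).left → A₀.X.left.Opens := fun y ↦
    Θ.U (k y) ⊓ (A₀.translation c⁻¹).left ⁻¹ᵁ (ι₀ ⁻¹ᵁ β.W y)
  let h : (y : ↥(A₀.X ⊗ dualNumberOver).left) → Γ(A₀.X.left, V y) := fun y ↦
    (A₀.translation c⁻¹).left.appLE (ι₀ ⁻¹ᵁ β.W y) (V y) inf_le_right (-(m₁ y * n₀ y))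
  refine ⟨↥(A₀.X ⊗ dualNumberOver).left, V, k, fun y ↦ inf_le_left, fun P ↦ ?_, h, fun a b P hPa hPb hx ↦ ?_⟩
  · -- the `V_y` cover the closed points: `P ∈ V_{(P c⁻¹, ε)}`
    refine ⟨dualNumberBasePt (slicePt A₀.X (AlgPoints.map (A₀.translation c⁻¹) P)), ?_, ?_⟩
    · dsimp only [k]
      rw [hTσ, hmapc]
      exact Θ.mem_U_chartIdx _
    · change ι₀.base (AlgPoints.map (A₀.translation c⁻¹) P).pt ∈ β.W _
      rw [← hσι]
      exact β.mem _
  · -- the main identity at `P`, read at the slice point of `P' = t_{c⁻¹} P = P c⁻¹`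
    set P' : A₀.Points ℂ := AlgPoints.map (A₀.translation c⁻¹) P with hP'
    have hP'c : P' * c = P := hmapc P
    have hcomp : w ≫ A₀.translation P' = w₀ ≫ A₀.translation P := by
      rw [hw, Category.assoc, translation_comp, hP'c]
    have hP'a : P'.pt ∈ ι₀ ⁻¹ᵁ β.W a := hPa.2
    have hP'b : P'.pt ∈ ι₀ ⁻¹ᵁ β.W b := hPb.2
    have hσa : dualNumberBasePt (slicePt A₀.X P') ∈ β.W a := by rw [hσι]; exact hP'a
    have hσb : dualNumberBasePt (slicePt A₀.X P') ∈ β.W b := by rw [hσι]; exact hP'b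
    -- the coboundary relation on `V' = W_b ∩ W_a`, read at the slice point
    have hσV : dualNumberBasePt (slicePt A₀.X P') ∈ β.W b ⊓ β.W a := ⟨hσb, hσa⟩
    have rel := β.rel b a (β.W b ⊓ β.W a) inf_le_left inf_le_right
    have ρrel := congrArg (fun s ↦ dualNumberStalkHom (slicePt A₀.X P')
      ((A₀.X ⊗ dualNumberOver).left.presheaf.germ (β.W b ⊓ β.W a) _ hσV s)) rel
    simp only [_root_.map_mul] at ρrel
    -- (1) the `λ`'s: restrictions of `λ_y := β.lam y (W y)`
    set ua := dualNumberStalkHom (slicePt A₀.X P')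
      ((A₀.X ⊗ dualNumberOver).left.presheaf.germ (β.W a) _ hσa (β.lam a (β.W a) le_rfl)) with hua
    set ub := dualNumberStalkHom (slicePt A₀.X P')
      ((A₀.X ⊗ dualNumberOver).left.presheaf.germ (β.W b) _ hσb (β.lam b (β.W b) le_rfl)) with hub
    have hlam_a : dualNumberStalkHom (slicePt A₀.X P') ((A₀.X ⊗ dualNumberOver).left.presheaf.germ
        (β.W b ⊓ β.W a) _ hσV (β.lam a (β.W b ⊓ β.W a) inf_le_right)) = ua := by
      rw [hua, ← β.map_lam a le_rfl inf_le_right]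
      exact congrArg _ (TopCat.Presheaf.germ_res_apply _ (homOfLE inf_le_right) _ hσV _)
    have hlam_b : dualNumberStalkHom (slicePt A₀.X P') ((A₀.X ⊗ dualNumberOver).left.presheaf.germ
        (β.W b ⊓ β.W a) _ hσV (β.lam b (β.W b ⊓ β.W a) inf_le_left)) = ub := by
      rw [hub, ← β.map_lam b le_rfl inf_le_left]
      exact congrArg _ (TopCat.Presheaf.germ_res_apply _ (homOfLE inf_le_left) _ hσV _)
    -- (2) the `pr₁`-part is a scalar
    have hFU : P'.pt ∈ cN.U ((CartesianMonoidalCategory.fst A₀.X dualNumberOver).left.base b) ⊓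
        cN.U ((CartesianMonoidalCategory.fst A₀.X dualNumberOver).left.base a) := by
      have hb' : dualNumberBasePt (slicePt A₀.X P') ∈ cF.U b := β.le' b hσb
      have ha' : dualNumberBasePt (slicePt A₀.X P') ∈ cF.U a := β.le' a hσa
      change (CartesianMonoidalCategory.fst A₀.X dualNumberOver).left.base (dualNumberBasePt (slicePt A₀.X P')) ∈
        cN.U ((CartesianMonoidalCategory.fst A₀.X dualNumberOver).left.base b) at hb'
      change (CartesianMonoidalCategory.fst A₀.X dualNumberOver).left.base (dualNumberBasePt (slicePt A₀.X P')) ∈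
        cN.U ((CartesianMonoidalCategory.fst A₀.X dualNumberOver).left.base a) at ha'
      rw [fst_base_dualNumberBasePt_slicePt] at hb' ha'
      exact ⟨hb', ha'⟩
    obtain ⟨f, hf⟩ : ∃ f : ℂ, dualNumberStalkHom (slicePt A₀.X P')
        ((A₀.X ⊗ dualNumberOver).left.presheaf.germ (β.W b ⊓ β.W a) _ hσV
          (cF.g b a (β.W b ⊓ β.W a) (inf_le_left.trans (β.le' b)) (inf_le_right.trans (β.le' a)))) =
          algebraMap ℂ ℂ[ε] f := by
      refine ⟨P'.eval _ hFU (cN.g _ _ _ inf_le_left inf_le_right), ?_⟩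
      refine (congrArg (dualNumberStalkHom (slicePt A₀.X P'))
        (TopCat.Presheaf.germ_res_apply (A₀.X ⊗ dualNumberOver).left.presheaf
          (homOfLE (UnitCocycle.le_preimage_inf (CartesianMonoidalCategory.fst A₀.X dualNumberOver).left
            (inf_le_left.trans (β.le' b)) (inf_le_right.trans (β.le' a)))) _ hσV _)).trans ?_
      exact dualNumberStalkHom_slicePt_fst_app P' _ hFU _ _
    -- (3) the `T_w`-part is the read-out of `g_{k b, k a}` at `w₀ ≫ t_P`
    have hU' : dualNumberBasePt (w ≫ A₀.translation P') ∈ Θ.U (k b) ⊓ Θ.U (k a) := by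
      rw [hbase, hP'c]
      exact ⟨hPb.1, hPa.1⟩
    have hG : dualNumberStalkHom (slicePt A₀.X P')
        ((A₀.X ⊗ dualNumberOver).left.presheaf.germ (β.W b ⊓ β.W a) _ hσV
          (cT.g b a (β.W b ⊓ β.W a) (inf_le_left.trans (β.le b)) (inf_le_right.trans (β.le a)))) =
          dualNumberStalkHom (w₀ ≫ A₀.translation P)
            (A₀.X.left.presheaf.germ (Θ.U (k b) ⊓ Θ.U (k a)) _ hx (Θ.transFun (k b) (k a))) := by
      have hTV : β.W b ⊓ β.W a ≤ T.left ⁻¹ᵁ (Θ.U (k b) ⊓ Θ.U (k a)) :=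
        UnitCocycle.le_preimage_inf T.left (inf_le_left.trans (β.le b)) (inf_le_right.trans (β.le a))
      calc dualNumberStalkHom (slicePt A₀.X P')
            ((A₀.X ⊗ dualNumberOver).left.presheaf.germ (β.W b ⊓ β.W a) _ hσV
              (cT.g b a (β.W b ⊓ β.W a) (inf_le_left.trans (β.le b)) (inf_le_right.trans (β.le a))))
          = dualNumberStalkHom (slicePt A₀.X P')
              ((A₀.X ⊗ dualNumberOver).left.presheaf.germ (T.left ⁻¹ᵁ (Θ.U (k b) ⊓ Θ.U (k a))) _ (hTV hσV)
                (T.left.app (Θ.U (k b) ⊓ Θ.U (k a))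
                  (A₀.X.left.presheaf.map (homOfLE (le_inf inf_le_left inf_le_right)).op
                    (Θ.transFun (k b) (k a))))) :=
            congrArg (dualNumberStalkHom (slicePt A₀.X P'))
              (TopCat.Presheaf.germ_res_apply (A₀.X ⊗ dualNumberOver).left.presheaf (homOfLE hTV) _ hσV _)
        _ = dualNumberStalkHom (w ≫ A₀.translation P')
              (A₀.X.left.presheaf.germ (Θ.U (k b) ⊓ Θ.U (k a)) _ hU'
                (A₀.X.left.presheaf.map (homOfLE (le_inf inf_le_left inf_le_right)).op
                  (Θ.transFun (k b) (k a)))) :=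
            dualNumberStalkHom_slicePt_translationFamily A₀ P' w _ hU' _
        _ = dualNumberStalkHom (w ≫ A₀.translation P')
              (A₀.X.left.presheaf.germ (Θ.U (k b) ⊓ Θ.U (k a)) _ hU' (Θ.transFun (k b) (k a))) :=
            congrArg (dualNumberStalkHom (w ≫ A₀.translation P'))
              (TopCat.Presheaf.germ_res_apply A₀.X.left.presheaf
                (homOfLE (le_inf inf_le_left inf_le_right : Θ.U (k b) ⊓ Θ.U (k a) ≤ _)) _ hU' _)
        _ = _ := dualNumberStalkHom_congr hcomp _ _ hx _
    -- (4) the read-outs of `λ_a`, `λ_b` and their inverses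
    have hm₀a : ua.fst = P'.eval (ι₀ ⁻¹ᵁ β.W a) hP'a (m₀ a) := (hm a P' hP'a hσa).1
    have hm₁a : ua.snd = P'.eval (ι₀ ⁻¹ᵁ β.W a) hP'a (m₁ a) := (hm a P' hP'a hσa).2
    have hm₀b : ub.fst = P'.eval (ι₀ ⁻¹ᵁ β.W b) hP'b (m₀ b) := (hm b P' hP'b hσb).1
    have hm₁b : ub.snd = P'.eval (ι₀ ⁻¹ᵁ β.W b) hP'b (m₁ b) := (hm b P' hP'b hσb).2
    have hn₀a : (dualNumberStalkHom (slicePt A₀.X P') ((A₀.X ⊗ dualNumberOver).left.presheaf.germ (β.W a) _ hσa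
        (β.inv a (β.W a) le_rfl))).fst = P'.eval (ι₀ ⁻¹ᵁ β.W a) hP'a (n₀ a) := (hn a P' hP'a hσa).1
    have hn₀b : (dualNumberStalkHom (slicePt A₀.X P') ((A₀.X ⊗ dualNumberOver).left.presheaf.germ (β.W b) _ hσb
        (β.inv b (β.W b) le_rfl))).fst = P'.eval (ι₀ ⁻¹ᵁ β.W b) hP'b (n₀ b) := (hn b P' hP'b hσb).1
    have hia : P'.eval (ι₀ ⁻¹ᵁ β.W a) hP'a (m₀ a) * P'.eval (ι₀ ⁻¹ᵁ β.W a) hP'a (n₀ a) =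
        1 := by
      rw [← hm₀a, ← hn₀a, ← TrivSqZeroExt.fst_mul, hua, ← _root_.map_mul, ← _root_.map_mul, β.lam_mul_inv,
        _root_.map_one, _root_.map_one, TrivSqZeroExt.fst_one]
    have hib : P'.eval (ι₀ ⁻¹ᵁ β.W b) hP'b (m₀ b) * P'.eval (ι₀ ⁻¹ᵁ β.W b) hP'b (n₀ b) =
        1 := by
      rw [← hm₀b, ← hn₀b, ← TrivSqZeroExt.fst_mul, hub, ← _root_.map_mul, ← _root_.map_mul, β.lam_mul_inv,
        _root_.map_one, _root_.map_one, TrivSqZeroExt.fst_one]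
    have hua0 : ua.fst ≠ 0 := by rw [hm₀a]; exact left_ne_zero_of_mul_eq_one hia
    have hub0 : ub.fst ≠ 0 := by rw [hm₀b]; exact left_ne_zero_of_mul_eq_one hib
    -- (5) algebra: `f · u_a = u_b · G`
    rw [hlam_a, hlam_b, hf, hG] at ρrel
    have key := snd_eq_of_inl_mul_eq_mul hub0 hua0 ρrel
    -- (6) rewrite the right-hand side in terms of `h`
    have hGfst : (dualNumberStalkHom (w₀ ≫ A₀.translation P)
        (A₀.X.left.presheaf.germ (Θ.U (k b) ⊓ Θ.U (k a)) _ hx (Θ.transFun (k b) (k a)))).fst =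
          P.eval (Θ.U (k b) ⊓ Θ.U (k a)) ⟨hPb.1, hPa.1⟩ (Θ.transFun (k b) (k a)) :=
      fst_dualNumberStalkHom_germ _ P (dualNumberBasePt_comp_translation_of_origin A₀ w₀ hw₀ P) _ hx _
    have hh : ∀ (y : ↥(A₀.X ⊗ dualNumberOver).left) (hPy : P.pt ∈ V y) (hP'y : P'.pt ∈ ι₀ ⁻¹ᵁ β.W y),
        P.eval (V y) hPy (h y) = -(P'.eval (ι₀ ⁻¹ᵁ β.W y) hP'y (m₁ y) *
          P'.eval (ι₀ ⁻¹ᵁ β.W y) hP'y (n₀ y)) := by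
      intro y hPy hP'y
      have e1 := AlgPoints.eval_appLE_eq_eval_map (A₀.translation c⁻¹) (U := V y)
        (V := ι₀ ⁻¹ᵁ β.W y) inf_le_right P hPy (-(m₁ y * n₀ y))
      refine e1.trans ?_
      exact (eval_neg' P' _ hP'y _).trans (congrArg Neg.neg (eval_mul' P' _ hP'y _ _))
    rw [key, hGfst, hh a hPa hP'a, hh b hPb hP'b, hm₀a, hm₁a, hm₀b, hm₁b, div_eq_mul_inv, div_eq_mul_inv,
      inv_eq_of_mul_eq_one_right hia, inv_eq_of_mul_eq_one_right hib]
    ring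

end Body

end Literature.AlgebraicGeometry.Motives.AbelianVariety

end
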